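import Summits.QuantumFields.BalabanUV.Beta.GAN24.CombHalfMemberSlavedDivergenceLaws
import Summits.QuantumFields.BalabanUV.Beta.GAN24.CombEvenTowerAutonomy
import Summits.QuantumFields.BalabanUV.Beta.CombChartContactFactor
import Summits.QuantumFields.BalabanUV.Beta.SpineRecursiveParity
import Summits.QuantumFields.BalabanUV.Beta.KernelWardRemainderParity

/-!
# `BalabanUV.Beta.GAN24.CombHalfMemberSlavedDivergenceParity` — binder row G-an2-4 ∕ (CONV-C), TRANSFER-III (the (α-0) chain at row D1's literal of record (III′)), PART 3′
# (lite) of `CombHalfMemberSlavedDivergence`: **AT THE COMB-CHART SLOT DATA TOO, THE EVEN MEMBER's SLAVED DIVERGENCE ONE LEVEL UP DOES NOT SEE THE WARD-LOCUS RESIDUAL —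
# THE PARITY LETTERS `hC hR hR″` OF PART 2′ DISCHARGED BY NAME** for table laws of an2's slot-generic shape (`S := SpureCombOf tabs … j`, block generator `X_Y := diagK (g Y)`,
# remainder `R := c • Σ_v mmRead Lc (G′_m ∘ 𝒩(Lc•Y+v) ∘ G′_m) + RB`): the commutator word is EVEN because the comb-chart pure first-order table is odd-rowed (the OWNER
# gan24-p1 g46's T2 `CombEvenTowerAutonomy.trK_SpureCombOf` under the table parities (V-p)(H-p) ⨾ MY `parityEven_comm_of_oddRows`), the `𝒩`-word is ODD because `𝒩` is
# (an1's sandwich `SpineRecursiveParity.parityOdd_sandwich` on an2's spread sgn-symmetric `G′_m` — `CombChartContactFactor.spr_GcombSh`, `CombChartWardSockets.trK_GcombSh` — ⨾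
# `parityOdd_mmRead ∕ _sum ∕ _smul ∕ _add`) — MY lineage's (E) file `HalfMemberSlavedDivergencePin` §4 (gen 72) RE-RUN at the comb data with the two TABLE LAWS KEPT DISPLAYED
# (G-an2-4 CRUX TEAM (2), leaf prover `b2b-balaban-gan24-formalise-leaf-01`, gen 80; the OWNER's (III′) link table R-gan24p1-g46-2, row «L8b–L9»; no existing file touched)

NOT IN PRINT; OUR BOOKKEEPING ([folklore] composition BY NAME; 0 `def`, 0 cited facts, 0 `def … : Prop`, 0 sorry).  HONEST FRAMING (cell contract, verbatim): «discharging
`BetaPertH` makes Bałaban's UV stability UNCONDITIONAL — a real constructive-QFT result; it is NOT the continuum limit and NOT the Clay problem.»  HONEST DEPENDENCY (verbatim):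
«continuum YM on T⁴ ⇐ BetaPertH ∧ nine spine estimates (0/9 proved); BetaPertH ⇐ (D1) ∧ (D4) ∧ CAP+tail; G-an2-4 gates asym, D1 and NE2/3/4.»

WHAT (level `j → j+1`, any sandwich level `m`, any weight `c`, any generator symbols `g`; any record `tabs : SymTables d Lc` with off-diagonal border `hBff hBmm` and the table
parities (V-p) `hVp`, (H-p) `hHp`; generic `d`, `Lc ≥ 1` via `[NeZero Lc]`): **`divW_evenMember_comb_succ_eq_slaved_of_laws`** — HYPOTHESES: the two TABLE LAWS `hTL ∕ hTL″` of the
RAW comb-chart member `T̃′_j` in EXACTLY the conclusion shape of an2's `WardLocusQuarticTableSlot.tableLaw_T2RecOf_succ ∕ ''` at `G := GcombSh Lc` (pure partner `SpureCombOf tabs … j`,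
generator `diagK (g Y)`, remainder `c • Σ_v mmRead Lc (G′_m ∘ 𝒩 (Lc•Y+v) κ′ u′ ∘ G′_m) + RB Y κ′ u′` resp. `… + RB″`), `cH′ ≠ 0`, a LOCALISED residual `𝒩` (`h𝒩`) with parity-ODD
slices (`h𝒩par` — road-P2's L3 `CombWardLawParitySplit` ∕ an2's `WardLocusCombSecondOrder` class at (III′)), parity-ODD border remainders (`hRB hRB″`); CONCLUSION: PART 2′'s
`divW_evenMember_comb_succ_eq_slaved` with `hC hR hR″` DISCHARGED — the even member's source-slot divergence one level up is `divW (b̃′♮^{ev}_j) + (c₄·(Lc^{d+1})⁻¹∕2) • (e3OfK Lc G′♮_j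
[(sf_j·sm_j)⁻¹ • unitS_j (κ′u′ ↦ cH′⁻¹ • (S′_j κ′u′ ∘ X_y − X_y ∘ S′_j κ′u′))] + the ″ twin)`, NO `𝒩`, NO `RB`.
WHAT THIS IS NOT.  The two table laws stay DISPLAYED (their discharge at the comb data = an2's slot-generic induction `WardLocusRecursiveAllSlot` with the resolvent sockets `h𝕄 hE hR
hEX hD hc1` at `GcombSh` — NOT here; MY (E) PART 3 had them from D1's `tableLaw_T2RecAt_succ` at the pin); NOT the level-`0` (Wilson) case; NOT one row of the S-∕W-slot, NO value;
asserts NOTHING about Bałaban's tables; the (III′) campaign is NOT asked (an2 W-4 l.64553) — zero weight; NEVER «G-an2-4 closed» as (CONV-C); NOT D1, NOT `BetaPertH`, NOT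
continuum, NOT Clay.  2026-08-25.
-/

noncomputable section

open Finset
open scoped BigOperators
open Literature.MathematicalPhysics.QuantumFieldTheory
open Literature.MathematicalPhysics.QuantumFieldTheory.Balaban1983to89
open Literature.MathematicalPhysics.QuantumFieldTheory.Balaban1983to89.Beta
open ExpKernelCalculus (MKer Decays comp)
open OneStepResolventKernel (Fib)
open SecondOrderResponse (W2SymOfK)
open BalabanStepJetsSucc (mmRead)
open BalabanStepW2 (K3OfK M2Of)
open KernelWard (divV divW)
open AffineAveraging (box toSite)
open Summit.QuantumFields.BalabanUV.Beta.TameKernelCalculus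
open Summit.QuantumFields.BalabanUV.Beta.BorderedHessian (sgnK diagK)
open Summit.QuantumFields.BalabanUV.Beta.HessKerDressedUnits (unitK unitS)
open Summit.QuantumFields.BalabanUV.Beta.SecondOrderUnits (unitM unitS₂ unitM₂)
open Summit.QuantumFields.BalabanUV.Beta.SpineRooted (T2RecOf e3OfK)
open Summit.QuantumFields.BalabanUV.Beta.SymmetrisedStepJets (SymTables)
open Summit.QuantumFields.BalabanUV.Beta.CombChartStepJets (GcombSh SpureCombOf)
open Summit.QuantumFields.BalabanUV.Beta.CombChartContactFactor (spr_GcombSh)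
open Summit.QuantumFields.BalabanUV.Beta.CombChartWardSockets (trK_GcombSh)
open Summit.QuantumFields.BalabanUV.Beta.KernelWardRemainderParity (parityOdd_add)
open Summit.QuantumFields.BalabanUV.Beta.SpineRecursiveParity (parityOdd_smul parityOdd_sum parityOdd_mmRead parityOdd_sandwich)
open Summit.QuantumFields.BalabanUV.Beta.GAN24.CombesThomas (sfStep smStep)
open Summit.QuantumFields.BalabanUV.Beta.GAN24.HalfMemberSlavedDivergence (parityEven_comm_of_oddRows)
open Summit.QuantumFields.BalabanUV.Beta.GAN24.CombEvenTowerAutonomy (trK_SpureCombOf)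
open Summit.QuantumFields.BalabanUV.Beta.GAN24.CombHalfMemberSlavedDivergenceLaws (divW_evenMember_comb_succ_eq_slaved)

namespace Summit.QuantumFields.BalabanUV.Beta.GAN24.CombHalfMemberSlavedDivergenceParity

variable {d : ℕ} {Lc : ℕ} [NeZero Lc]

/-! ## §3 The even comb-chart member under table laws of an2's slot-generic shape: parities discharged by name -/

/-- NOT IN PRINT; OUR BOOKKEEPING.  **THE EVEN COMB-CHART MEMBER's SLAVED DIVERGENCE, LEVEL `j → j+1`, PARITY LETTERS DISCHARGED** (table laws `hTL hTL″` displayed in an2's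
slot-generic conclusion shape; `cH′ ≠ 0`; `𝒩` localised with parity-odd slices; border remainders parity-odd): the commutator word survives (EVEN: the OWNER's `trK_SpureCombOf` ⨾
`parityEven_comm_of_oddRows`), the `𝒩`-word + border remainder DROPS (ODD: `parityOdd_sandwich` on `spr_GcombSh ∕ trK_GcombSh` ⨾ `parityOdd_mmRead` ⨾ `parityOdd_sum` ⨾ `parityOdd_smul`
⨾ `parityOdd_add`).  The (III′) twin of MY g72 `HalfMemberSlavedDivergencePin.divW_evenMember_succ_succ_eq_slaved` with the table laws kept as hypotheses. -/
theorem divW_evenMember_comb_succ_eq_slaved_of_laws (tabs : SymTables d Lc)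
    (hVp : ∀ (κ : Fin (d + 1)) (u : Fin (d + 1) → ℤ), trK (tabs.V κ u) = -sgnK (tabs.V κ u))
    (hHp : ∀ (μ : Fin (d + 1)) (y : Fin (d + 1) → ℤ), trK (tabs.H μ y) = -sgnK (tabs.H μ y))
    (cE cVH cΛ cE₂ cB : ℝ) (Tc : Fin 4 → Fin 4 → Fin 4 → Fin 4 → ℝ)
    (hBff : ∀ κ u κ' u' x z (α β : Fin (d + 1)), tabs.vh₂S κ u κ' u' x z (Sum.inl α) (Sum.inl β) = 0)
    (hBmm : ∀ κ u κ' u' x z (μ ν : Fin (d + 1)), tabs.vh₂S κ u κ' u' x z (Sum.inr μ) (Sum.inr ν) = 0) (j : ℕ)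
    (g : (Fin (d + 1) → ℤ) → (Fin (d + 1) → ℤ) → Fib d → ℝ) (m : ℕ)
    {𝒩 : (Fin (d + 1) → ℤ) → Fin (d + 1) → (Fin (d + 1) → ℤ) → MKer (d + 1) (Fib d)} (h𝒩 : ∀ y κ u, Loc (𝒩 y κ u))
    (h𝒩par : ∀ (y : Fin (d + 1) → ℤ) (κ : Fin (d + 1)) (u : Fin (d + 1) → ℤ), trK (𝒩 y κ u) = -sgnK (𝒩 y κ u)) (c : ℝ)
    {RB RB'' : (Fin (d + 1) → ℤ) → Fin (d + 1) → (Fin (d + 1) → ℤ) → MKer (d + 1) (Fib d)}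
    (hRB : ∀ (Y : Fin (d + 1) → ℤ) (κ : Fin (d + 1)) (u : Fin (d + 1) → ℤ), trK (RB Y κ u) = -sgnK (RB Y κ u))
    (hRB'' : ∀ (Y : Fin (d + 1) → ℤ) (κ : Fin (d + 1)) (u : Fin (d + 1) → ℤ), trK (RB'' Y κ u) = -sgnK (RB'' Y κ u))
    {cH' : ℝ} (hcH : cH' ≠ 0)
    (hTL : ∀ (Y : Fin (d + 1) → ℤ) (κ' : Fin (d + 1)) (u' : Fin (d + 1) → ℤ),
      cH' • ∑ v ∈ box (d + 1) Lc, divV (fun κ u => T2RecOf d Lc (GcombSh Lc) (SpureCombOf tabs cE cVH cΛ) tabs.M cE₂ cB Tc tabs.vh₂S tabs.mixFF j κ u κ' u') ((Lc : ℤ) • Y + toSite v)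
        = comp (SpureCombOf tabs cE cVH cΛ j κ' u') (diagK (g Y)) - comp (diagK (g Y)) (SpureCombOf tabs cE cVH cΛ j κ' u') + (c • ∑ v ∈ box (d + 1) Lc, mmRead Lc (comp (comp (GcombSh (d := d) Lc m) (𝒩 ((Lc : ℤ) • Y + toSite v) κ' u')) (GcombSh (d := d) Lc m)) + RB Y κ' u'))
    (hTL'' : ∀ (Y : Fin (d + 1) → ℤ) (κ : Fin (d + 1)) (u : Fin (d + 1) → ℤ),
      cH' • ∑ v ∈ box (d + 1) Lc, divV (T2RecOf d Lc (GcombSh Lc) (SpureCombOf tabs cE cVH cΛ) tabs.M cE₂ cB Tc tabs.vh₂S tabs.mixFF j κ u) ((Lc : ℤ) • Y + toSite v)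
        = comp (SpureCombOf tabs cE cVH cΛ j κ u) (diagK (g Y)) - comp (diagK (g Y)) (SpureCombOf tabs cE cVH cΛ j κ u) + (c • ∑ v ∈ box (d + 1) Lc, mmRead Lc (comp (comp (GcombSh (d := d) Lc m) (𝒩 ((Lc : ℤ) • Y + toSite v) κ u)) (GcombSh (d := d) Lc m)) + RB'' Y κ u))
    (y : Fin (d + 1) → ℤ) (ν : Fin (d + 1)) (y' : Fin (d + 1) → ℤ) :
    divW ((1 / 2 : ℝ) • (unitS₂ (sfStep Lc (j + 1)) (smStep d Lc (j + 1)) (T2RecOf d Lc (GcombSh Lc) (SpureCombOf tabs cE cVH cΛ) tabs.M cE₂ cB Tc tabs.vh₂S tabs.mixFF (j + 1))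
          + fun κ u κ' u' => sgnK (trK (unitS₂ (sfStep Lc (j + 1)) (smStep d Lc (j + 1)) (T2RecOf d Lc (GcombSh Lc) (SpureCombOf tabs cE cVH cΛ) tabs.M cE₂ cB Tc tabs.vh₂S tabs.mixFF (j + 1)) κ u κ' u')))) y ν y'
      = divW ((1 / 2 : ℝ) • ((fun κ u κ' u' => (cE₂ * (Lc : ℝ) ^ (2 * (d + 1))) • mmRead Lc (K3OfK
            (unitK (sfStep Lc j) (smStep d Lc j) (GcombSh (d := d) Lc j)) Lc
            (unitS (sfStep Lc j) (smStep d Lc j) (SpureCombOf tabs cE cVH cΛ j)) (unitM (sfStep Lc j) (smStep d Lc j) (tabs.M j))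
            (W2SymOfK (unitK (sfStep Lc j) (smStep d Lc j) (GcombSh (d := d) Lc j)) Lc
              (unitS (sfStep Lc j) (smStep d Lc j) (SpureCombOf tabs cE cVH cΛ j)) (unitM (sfStep Lc j) (smStep d Lc j) (tabs.M j)) 0
              (unitM₂ (sfStep Lc j) (smStep d Lc j) (M2Of d Lc tabs.mixFF j))) κ u κ' u') + cB • tabs.vh₂S κ u κ' u')
          + fun κ u κ' u' => sgnK (trK ((fun κ u κ' u' => (cE₂ * (Lc : ℝ) ^ (2 * (d + 1))) • mmRead Lc (K3OfK
            (unitK (sfStep Lc j) (smStep d Lc j) (GcombSh (d := d) Lc j)) Lc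
            (unitS (sfStep Lc j) (smStep d Lc j) (SpureCombOf tabs cE cVH cΛ j)) (unitM (sfStep Lc j) (smStep d Lc j) (tabs.M j))
            (W2SymOfK (unitK (sfStep Lc j) (smStep d Lc j) (GcombSh (d := d) Lc j)) Lc
              (unitS (sfStep Lc j) (smStep d Lc j) (SpureCombOf tabs cE cVH cΛ j)) (unitM (sfStep Lc j) (smStep d Lc j) (tabs.M j)) 0
              (unitM₂ (sfStep Lc j) (smStep d Lc j) (M2Of d Lc tabs.mixFF j))) κ u κ' u') + cB • tabs.vh₂S κ u κ' u') κ u κ' u')))) y ν y'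
        + (cE₂ * (Lc : ℝ) ^ (2 * (d + 1)) * ((Lc : ℝ) ^ (d + 1))⁻¹ / 2) •
          (e3OfK Lc (unitK (sfStep Lc j) (smStep d Lc j) (GcombSh (d := d) Lc j))
              (fun κ' u' => (sfStep Lc j * smStep d Lc j)⁻¹ • unitS (sfStep Lc j) (smStep d Lc j)
                (fun κ' u' => cH'⁻¹ • (comp (SpureCombOf tabs cE cVH cΛ j κ' u') (diagK (g y)) - comp (diagK (g y)) (SpureCombOf tabs cE cVH cΛ j κ' u'))) κ' u') ν y'
            + e3OfK Lc (unitK (sfStep Lc j) (smStep d Lc j) (GcombSh (d := d) Lc j))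
              (fun κ u => (sfStep Lc j * smStep d Lc j)⁻¹ • unitS (sfStep Lc j) (smStep d Lc j)
                (fun κ u => cH'⁻¹ • (comp (SpureCombOf tabs cE cVH cΛ j κ u) (diagK (g y)) - comp (diagK (g y)) (SpureCombOf tabs cE cVH cΛ j κ u))) κ u) ν y') := by
  -- the commutator word is EVEN (odd-rowed `SpureCombOf`: the OWNER's T2 `trK_SpureCombOf`), the remainders are ODD (`𝒩` odd in an even `G′_m`-sandwich; border letters)
  have hC : ∀ (Y : Fin (d + 1) → ℤ) (κ : Fin (d + 1)) (u : Fin (d + 1) → ℤ),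
      trK (comp (SpureCombOf tabs cE cVH cΛ j κ u) (diagK (g Y)) - comp (diagK (g Y)) (SpureCombOf tabs cE cVH cΛ j κ u))
        = sgnK (comp (SpureCombOf tabs cE cVH cΛ j κ u) (diagK (g Y)) - comp (diagK (g Y)) (SpureCombOf tabs cE cVH cΛ j κ u)) :=
    fun Y κ u => parityEven_comm_of_oddRows (trK_SpureCombOf tabs hVp hHp cE cVH cΛ j) g Y κ u
  have hR : ∀ (Y : Fin (d + 1) → ℤ) (κ' : Fin (d + 1)) (u' : Fin (d + 1) → ℤ), trK (c • ∑ v ∈ box (d + 1) Lc, mmRead Lc (comp (comp (GcombSh (d := d) Lc m) (𝒩 ((Lc : ℤ) • Y + toSite v) κ' u')) (GcombSh (d := d) Lc m)) + RB Y κ' u') = -sgnK (c • ∑ v ∈ box (d + 1) Lc, mmRead Lc (comp (comp (GcombSh (d := d) Lc m) (𝒩 ((Lc : ℤ) • Y + toSite v) κ' u')) (GcombSh (d := d) Lc m)) + RB Y κ' u') :=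
    fun Y κ' u' => parityOdd_add (parityOdd_smul _ (parityOdd_sum _ fun v _ =>
      parityOdd_mmRead Lc (parityOdd_sandwich (spr_GcombSh (d := d) (Lc := Lc) m) (h𝒩 _ κ' u') (trK_GcombSh (d := d) (Lc := Lc) m) (h𝒩par _ κ' u')))) (hRB Y κ' u')
  have hR'' : ∀ (Y : Fin (d + 1) → ℤ) (κ : Fin (d + 1)) (u : Fin (d + 1) → ℤ), trK (c • ∑ v ∈ box (d + 1) Lc, mmRead Lc (comp (comp (GcombSh (d := d) Lc m) (𝒩 ((Lc : ℤ) • Y + toSite v) κ u)) (GcombSh (d := d) Lc m)) + RB'' Y κ u) = -sgnK (c • ∑ v ∈ box (d + 1) Lc, mmRead Lc (comp (comp (GcombSh (d := d) Lc m) (𝒩 ((Lc : ℤ) • Y + toSite v) κ u)) (GcombSh (d := d) Lc m)) + RB'' Y κ u) :=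
    fun Y κ u => parityOdd_add (parityOdd_smul _ (parityOdd_sum _ fun v _ =>
      parityOdd_mmRead Lc (parityOdd_sandwich (spr_GcombSh (d := d) (Lc := Lc) m) (h𝒩 _ κ u) (trK_GcombSh (d := d) (Lc := Lc) m) (h𝒩par _ κ u)))) (hRB'' Y κ u)
  exact divW_evenMember_comb_succ_eq_slaved tabs cE cVH cΛ cE₂ cB Tc hBff hBmm j (X := fun Y => diagK (g Y))
    (R := fun Y κ' u' => (c • ∑ v ∈ box (d + 1) Lc, mmRead Lc (comp (comp (GcombSh (d := d) Lc m) (𝒩 ((Lc : ℤ) • Y + toSite v) κ' u')) (GcombSh (d := d) Lc m)) + RB Y κ' u'))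
    (R'' := fun Y κ u => (c • ∑ v ∈ box (d + 1) Lc, mmRead Lc (comp (comp (GcombSh (d := d) Lc m) (𝒩 ((Lc : ℤ) • Y + toSite v) κ u)) (GcombSh (d := d) Lc m)) + RB'' Y κ u))
    hcH hTL hTL'' hC hR hR'' y ν y'

end Summit.QuantumFields.BalabanUV.Beta.GAN24.CombHalfMemberSlavedDivergenceParity

end
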